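import Literature.Algebra.Lie.LefschetzModuleWeylOperator
import Literature.Algebra.Lie.LefschetzModuleSelfAdjoint
import HarnessLib

/-!
# The Weyl operator and André's `*_H` are self-adjoint for a Poincaré-type pairing; for `(x, y) ↦ B(x, *_H y)` the
# transposition EXCHANGES `L` and `ᶜΛ` (André 1996, §1.1 remark; Prop. 1.2, last clause)

Topic `Literature/Algebra/Lie` (namespace `Literature.Algebra.Lie`).  Lane `lit-hodgefound` (Track 2 foundations library),
prover seat `lit-hodgefound-p34` (generation 31, row g31-#4), a sequel of `LefschetzModuleWeylOperator.lean` (g31-#1: the Weyl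
operator `w` and André's `*_H = andreHodgeInvolution` with the factor `k!/(d−j+k)!`, `*_H L *_H = ᶜΛ`) and of
`LefschetzModuleSelfAdjoint.lean` (g30-#3: the Poincaré-type setting `h` skew-adjoint, `e` self-adjoint; strings are `B`-orthogonal
unless matched; `*_L`, Kleiman's `⋆`, `ᶜΛ` self-adjoint).  THEOREMS ONLY (no definition, no named fact, no instance, no notation;
D-0026 net debt `0`).

## Source, VERBATIM (Y. André, Publ. Math. IHÉS 83 (1996), held `paper:doi-10-1007-bf02698643`)

§1.1 (p. 11 = p0008 L12–L14): "Remarquons aussi que `L`, `*_L`, `*_H` et `ᶜΛ` sont auto-adjoints relativement à l'accouplement de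
dualité de Poincaré `(x, y) ↦ ∫ x ∪ y`."  Prop. 1.2 (p. 11 = p0008 L62–L66): "[…] ces algèbres sont canoniquement isomorphes à une somme
d'algèbres matricielles `M_{i+1}(ℚ)` […]. Via cet isomorphisme, la transposition relative à la forme bilinéaire `(x, y) ↦ ∫ x ∪ *y`
correspond à la transposition des matrices, pour `* = *_L ou *_H`."  §1.2 (p. 11): `ᶜΛ ↦ (0 1 ; 0 0)`, `L ↦ (0 0 ; 1 0)` — transposed
matrices.  Here `*_H` is ANDRÉ'S involution (with its factor): then the `B(·, *_H ·)`-transpose of `L` is `*_H L *_H = ᶜΛ` ON THE NOSE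
(`isAdjointPair_compl₂_andreHodgeInvolution`), the matrix statement "subdiagonal ↦ superdiagonal".

## Contents (all proved; `B` a bilinear form with `h` skew-adjoint and `e` self-adjoint — a Poincaré-type pairing)

* **`isSelfAdjoint_andreHodgeInvolution`** (André's `*_H` is self-adjoint: on matched strings the two coefficients
  `(−1)^{(d−k)(d−k+1)/2} j!/(k−j)!` coincide), **`isSelfAdjoint_weylOperator`** (`w` is self-adjoint, same mechanism with
  `(−1)^{k+j} j!/(k−j)!`);
* **`isAdjointPair_compl₂_andreHodgeInvolution`** / `…'` (`L` and `ᶜΛ` are mutually adjoint for `(x, y) ↦ B(x, *_H y)`),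
  `isAdjointPair_compl₂_weylOperator` (`L` and `−ᶜΛ` are mutually adjoint for `(x, y) ↦ B(x, w y)`);
* `exists_isAdjointPair_of_mem_adjoin_pair_andreHodgeInvolution` (`K[L, *_H]` is stable under transposition).

## References

* [Andre1996Motifs] Y. André, *Pour une théorie inconditionnelle des motifs*, Publ. Math. IHÉS 83 (1996) 5–49, §1.1 (p. 11), §1.2 (p. 11),
  Prop. 1.2 (pp. 11–12).
-/

noncomputable section

namespace Literature.Algebra.Lie

open Module Function Set
open scoped Nat
open LinearMap (BilinForm)
open HasLefschetzProperty (primitiveSpace mem_primitiveSpace_iff)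

variable {K : Type*} [Field K] [CharZero K] {M : Type*} [AddCommGroup M] [Module K M] [FiniteDimensional K M]
  {B : BilinForm K M} {h e : Module.End K M}

namespace HasLefschetzProperty

/-- **"`*_H` […] auto-adjoint relativement à l'accouplement de dualité de Poincaré"**, for ANDRÉ'S `*_H`: `B(*_H x, y) = B(x, *_H y)`
when `h` is skew-adjoint and `e` self-adjoint (on strings: both sides vanish unless the strings have equal length `k` and equal position
`j`, and then both coefficients are `(−1)^{(d−k)(d−k+1)/2} j!/(k−j)!`). [cite: Andre1996Motifs, §1.1 (p. 11)] -/
theorem isSelfAdjoint_andreHodgeInvolution (L : HasLefschetzProperty h e) (hgr : IsZGrading h) (d : ℕ) (hh : B.IsSkewAdjoint h)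
    (he : B.IsSelfAdjoint e) : B.IsSelfAdjoint (L.andreHodgeInvolution hgr d) := by
  refine isAdjointPair_of_strings L hgr fun k p hp j hj k' p' hp' j' hj' ↦ ?_
  rw [L.andreHodgeInvolution_apply_pow_primitive hgr d hp hj, L.andreHodgeInvolution_apply_pow_primitive hgr d hp' hj', map_smul,
    LinearMap.smul_apply, map_smul, smul_eq_mul, smul_eq_mul]
  by_cases hm : k = k' ∧ j = j'
  · obtain ⟨rfl, rfl⟩ := hm
    rw [apply_pow_primitive_pow_primitive_eq he (show k - j + j = k by omega),
      apply_pow_primitive_pow_primitive_eq he (show j + (k - j) = k by omega)]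
  · rw [apply_pow_primitive_pow_primitive_eq_zero L hh he hp hp' (fun h' ↦ hm ⟨h'.1, by omega⟩),
      apply_pow_primitive_pow_primitive_eq_zero L hh he hp hp' (fun h' ↦ hm ⟨h'.1, by omega⟩), mul_zero, mul_zero]

/-- **The Weyl operator is self-adjoint for a Poincaré-type pairing**: `B(w x, y) = B(x, w y)` (on matched strings both coefficients are
`(−1)^{k+j} j!/(k−j)!`). [cite: Andre1996Motifs, §1.1 (p. 11) and §1.2 (p. 11, "(0 1 ; −1 0) … ± *_H")] -/
theorem isSelfAdjoint_weylOperator (L : HasLefschetzProperty h e) (hgr : IsZGrading h) (hh : B.IsSkewAdjoint h)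
    (he : B.IsSelfAdjoint e) : B.IsSelfAdjoint (L.weylOperator hgr) := by
  refine isAdjointPair_of_strings L hgr fun k p hp j hj k' p' hp' j' hj' ↦ ?_
  rw [L.weylOperator_apply_pow_primitive hgr hp hj, L.weylOperator_apply_pow_primitive hgr hp' hj', map_smul, LinearMap.smul_apply,
    map_smul, smul_eq_mul, smul_eq_mul]
  by_cases hm : k = k' ∧ j = j'
  · obtain ⟨rfl, rfl⟩ := hm
    rw [apply_pow_primitive_pow_primitive_eq he (show k - j + j = k by omega),
      apply_pow_primitive_pow_primitive_eq he (show j + (k - j) = k by omega)]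
  · rw [apply_pow_primitive_pow_primitive_eq_zero L hh he hp hp' (fun h' ↦ hm ⟨h'.1, by omega⟩),
      apply_pow_primitive_pow_primitive_eq_zero L hh he hp hp' (fun h' ↦ hm ⟨h'.1, by omega⟩), mul_zero, mul_zero]

/-- **Prop. 1.2, last clause, for André's `*_H`: `L` and `ᶜΛ` are mutually adjoint for `(x, y) ↦ B(x, *_H y)`** —
`B(e x, *_H y) = B(x, *_H (ᶜΛ y))` (`= B(x, *_H ((*_H e *_H) y))` and `*_H e *_H = ᶜΛ`): "la transposition relative à la forme bilinéaire
`(x, y) ↦ ∫ x ∪ *y` correspond à la transposition des matrices" (`L ↦ (0 0 ; 1 0)`, `ᶜΛ ↦ (0 1 ; 0 0)`).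
[cite: Andre1996Motifs, Prop. 1.2 (p. 11, "pour * = *_L ou *_H") and §1.2 (p. 11)] -/
theorem isAdjointPair_compl₂_andreHodgeInvolution (L : HasLefschetzProperty h e) (hgr : IsZGrading h) (d : ℕ)
    (he : B.IsSelfAdjoint e) :
    LinearMap.IsAdjointPair (B.compl₂ (L.andreHodgeInvolution hgr d)) (B.compl₂ (L.andreHodgeInvolution hgr d)) ⇑e ⇑(L.dual hgr) := by
  intro x y
  rw [LinearMap.compl₂_apply, LinearMap.compl₂_apply, he, ← L.andreHodgeInvolution_mul_e_mul_andreHodgeInvolution hgr d,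
    Module.End.mul_apply, Module.End.mul_apply, L.andreHodgeInvolution_andreHodgeInvolution hgr d]

/-- … and symmetrically `B(ᶜΛ x, *_H y) = B(x, *_H (e y))` (`ᶜΛ` and `*_H` self-adjoint).
[cite: Andre1996Motifs, Prop. 1.2 (p. 11, "pour * = *_L ou *_H")] -/
theorem isAdjointPair_compl₂_andreHodgeInvolution' (L : HasLefschetzProperty h e) (hgr : IsZGrading h) (d : ℕ)
    (hh : B.IsSkewAdjoint h) (he : B.IsSelfAdjoint e) :
    LinearMap.IsAdjointPair (B.compl₂ (L.andreHodgeInvolution hgr d)) (B.compl₂ (L.andreHodgeInvolution hgr d)) ⇑(L.dual hgr) ⇑e := by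
  intro x y
  have hs := L.isSelfAdjoint_andreHodgeInvolution hgr d hh he
  rw [LinearMap.compl₂_apply, LinearMap.compl₂_apply, ← L.andreHodgeInvolution_mul_e_mul_andreHodgeInvolution hgr d,
    Module.End.mul_apply, Module.End.mul_apply, hs, he, hs, L.andreHodgeInvolution_andreHodgeInvolution hgr d]

/-- For the Weyl operator: **`L` and `−ᶜΛ` are mutually adjoint for `(x, y) ↦ B(x, w y)`** — `B(e x, w y) = B(x, w (−ᶜΛ y))`
(`e w = −w ᶜΛ`, i.e. `(0 1 ; −1 0)` conjugates `ᶜΛ` into `−L`). [cite: Andre1996Motifs, §1.2 (p. 11)] -/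
theorem isAdjointPair_compl₂_weylOperator (L : HasLefschetzProperty h e) (hgr : IsZGrading h) (he : B.IsSelfAdjoint e) :
    LinearMap.IsAdjointPair (B.compl₂ (L.weylOperator hgr)) (B.compl₂ (L.weylOperator hgr)) ⇑e ⇑(-L.dual hgr) := by
  intro x y
  have h1 := LinearMap.congr_fun (L.weylOperator_mul_dual hgr) y
  rw [Module.End.mul_apply, LinearMap.neg_apply, Module.End.mul_apply] at h1
  rw [LinearMap.compl₂_apply, LinearMap.compl₂_apply, he, LinearMap.neg_apply, map_neg, h1, neg_neg]

/-- **`K[L, *_H]` is stable under transposition for the Poincaré pairing** (its generators `L`, `*_H` are self-adjoint).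
[cite: Andre1996Motifs, §1.1 (p. 11) and Prop. 1.2 (p. 11)] -/
theorem exists_isAdjointPair_of_mem_adjoin_pair_andreHodgeInvolution (L : HasLefschetzProperty h e) (hgr : IsZGrading h) (d : ℕ)
    (hh : B.IsSkewAdjoint h) (he : B.IsSelfAdjoint e) {T : Module.End K M}
    (hT : T ∈ Algebra.adjoin K ({e, L.andreHodgeInvolution hgr d} : Set (Module.End K M))) :
    ∃ T' ∈ Algebra.adjoin K ({e, L.andreHodgeInvolution hgr d} : Set (Module.End K M)), LinearMap.IsAdjointPair B B T T' := by
  refine exists_isAdjointPair_of_mem_adjoin ?_ hT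
  rintro a (rfl | rfl)
  · exact he
  · exact L.isSelfAdjoint_andreHodgeInvolution hgr d hh he

end HasLefschetzProperty

end Literature.Algebra.Lie
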